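import Literature.Computability.QuantumComplexity.SqrtTwoDyadicThresholds
import Literature.Computability.QuantumComplexity.ADHPathModel
import Literature.Computability.Cryptography.Postselection
import HarnessLib

/-!
# `PostBQP ⊆ PP` for Clifford+T, I: the postselected path-pair count and its sign

First file of the proof of Aaronson's `PostBQP ⊆ PP` (S. Aaronson, *Quantum computing,
postselection, and probabilistic polynomial-time*, Proc. R. Soc. A 461 (2005) 3473–3482 =
arXiv:quant-ph/0412187, Prop. 2 on the way to Thm. 4 `PostBQP = PP`; journal numbering Prop. 3 /
Thm. 2), for the tree's `PostBQP` (`Cryptography/Postselection.lean`: polynomial-time uniform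
oracle-free Clifford+`T` families, output wire `0`, postselection wire `1`, conditional
acceptance `≥ 2/3` / `≤ 1/3`) and `PP = pMajority P` (Gill). The printed proof: "we can use the same
observations used by Adleman, DeMarrais, and Huang to show that `BQP ⊆ PP`, but sum only over paths
where the first qubit is `|1⟩` at the end … we need to test which is greater: the sum `S₀` of
`α_z²` over all `z` beginning with `10`, or the sum `S₁` over all `z` beginning with `11` … put the
positive contributions `a_{z,i} a_{z,j}` to `S₁` and negative contributions to `S₀` on one side of
the ledger and the negative contributions to `S₁` and positive contributions to `S₀` on the other"
(Aaronson assumes a Hadamard+Toffoli circuit, whose path contributions are rational).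

**The Clifford+`T` subtlety.** Over Clifford+`T` the squared amplitudes are
`2^{-h}(A_z + (√2/2) B_z)` with the integer pair counts `A_z = pairSumA`, `B_z = pairSumB` of
`CliffordTPathSums.lean` — irrational in general. For `BQP ⊆ PP` (`adhW_pos`/`adhW_neg`) the
constant gap `1/3` allowed the rational weight `3/4` in place of `√2/2`; under postselection the
gap is only relative to `Pr[post = 1]`, which may be exponentially small, so the sign of
`S₁ − S₀ = 2^{-h-1}(2A + √2 B)` (`A = postA`, `B = postB` below) must be decided EXACTLY. This
file does so by Diophantine approximation, the standard remark that `PostBQP = PP` is insensitive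
to the gate set as long as the amplitudes are algebraic (G. Kuperberg, Theory Comput. 11 (2015),
§2.4): (i) `√2` is badly approximable — for integers `(a, b) ≠ 0`, `|2a + √2 b| ≥ 1/(4 max(1,|b|))`,
taken from the tree (`SqrtTwoDyadic.one_div_le_abs_sqrt_two_mul_sub`, Liouville's inequality, in
`SqrtTwoDyadicThresholds.lean`; here `quarter_div_le_abs`); (ii) the Pell convergents `p_n/q_n` of
`√2` (`pell`, `q_n ≥ 2^n`, `|p_n − √2 q_n| q_n < 1`, `pellP_sq_sub`) satisfy
`sign(2 q_n A + p_n B) = sign(2A + √2 B)` as soon as `|p_n − √2 q_n| |B| < q_n |2A + √2B|`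
(`sign_transfer_pos/neg`); (iii) with `|A_z|, |B_z| ≤ 4^μ` (`μ` gates) and `Pr[post] > 0`,
`|2A + √2 B| ≥ 2^{h+1} Pr[post]/3 ≥ 1/(12 · 2^M 4^μ)`, so `n = M + 2μ + 2` steps suffice:
**`weight_pos` / `weight_neg`** — if `Pr[out = 1 | post = 1] ≥ 2/3` then
`2 q_n · postA + p_n · postB > 0`, and if `≤ 1/3` then `< 0`. The integer `2 q_n postA + p_n postB`
is what the polynomial-time predicate of `PostBQPMachine.lean` makes the majority vote count
(`PostBQPSubsetPP.lean`).

**Why Pell convergents and not the dyadic floor.** `SqrtTwoDyadicThresholds.lean` (service file of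
`BQP ⊆ AWPP`) approximates the same forms `2A + √2B` by `dyadicGap A B k = 2^{k+1}A + ⌊2^k√2⌋B`,
which is the right proxy for a `GapP` VALUE. Here the polynomial-time PREDICATE of the majority
vote (file II) must itself produce the two weights as binary numerals on every input, and the
Pell pair `(q_n, P_n) ↦ (2q_n + P_n, q_n)` costs `n` big-number additions (`Brick.addFn` in a clocked
loop), whereas `⌊2^k √2⌋ = Nat.sqrt (2·4^k)` would need an integer square root of a `(2k+1)`-bit
number, for which the brick algebra has no component (`IsqrtBrick.lean` is unary). The two proxies
agree in spirit: both are `ℤ`-linear in `(A, B)` with a `√2`-approximation error beaten by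
Liouville's inequality.

Also: the bridges `postselectProbOn_eq_probPost`, `jointAcceptProbOn_eq_probJoint` from the
family-level probabilities of `Postselection.lean` to the `ζ`-semantics sums, and
`one_lt_of_postselectProbOn_pos` (a positive postselection probability forces `≥ 2` wires).

## References

* S. Aaronson, Proc. R. Soc. A 461 (2005) 3473–3482, arXiv:quant-ph/0412187: Def. 1, Prop. 2
  (`PostBQP ⊆ PP`), Thm. 4 (`PostBQP = PP`) [Aaronson2005].
* L. M. Adleman, J. DeMarrais, M.-D. A. Huang, *Quantum computability*, SIAM J. Comput. 26 (1997)
  1524–1540, Lemma 6.10 (the path-pair machine) [AdlemanDeMarraisHuang1997].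
* G. Kuperberg, *How hard is it to approximate the Jones polynomial?*, Theory Comput. 11 (2015)
  183–219, §2.4 (gate-set dependence of `PostBQP`; algebraic amplitudes) [Kuperberg2015].
* I. Niven, H. S. Zuckerman, H. L. Montgomery, *An Introduction to the Theory of Numbers*, 5th ed.,
  Wiley 1991, §7.8 (Pell's equation; the convergents of `√2`) — folklore number theory.
-/

noncomputable section

namespace Literature.Computability.QuantumComplexity

open _root_.Computability Complexity Cryptography Matrix

namespace PostADH

/-! ### Pell numbers: the convergents of `√2` -/

/-- The Pell pair `(P_{n+1}, P_n)`: `P₀ = 0`, `P₁ = 1`, `P_{n+2} = 2 P_{n+1} + P_n`. [folklore] -/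
def pell : ℕ → ℕ × ℕ
  | 0 => (1, 0)
  | n + 1 => (2 * (pell n).1 + (pell n).2, (pell n).1)

/-- The denominator `q_n = P_{n+1}` of the `n`-th convergent of `√2`. [folklore] -/
def pellQ (n : ℕ) : ℕ := (pell n).1

/-- The previous Pell number `P_n`. [folklore] -/
def pellQ' (n : ℕ) : ℕ := (pell n).2

/-- The numerator `p_n = P_{n+1} + P_n` of the `n`-th convergent `p_n/q_n` of `√2`
(`1/1, 3/2, 7/5, 17/12, 41/29, …`). [folklore] -/
def pellP (n : ℕ) : ℕ := pellQ n + pellQ' n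

/-- The recursion for `q`. [folklore] -/
theorem pellQ_succ (n : ℕ) : pellQ (n + 1) = 2 * pellQ n + pellQ' n := rfl

/-- The recursion for `q'`. [folklore] -/
theorem pellQ'_succ (n : ℕ) : pellQ' (n + 1) = pellQ n := rfl

/-- Initial values. [folklore] -/
@[simp] theorem pellQ_zero : pellQ 0 = 1 := rfl

/-- Initial values. [folklore] -/
@[simp] theorem pellQ'_zero : pellQ' 0 = 0 := rfl

/-- `P_n ≤ P_{n+1}`. [folklore] -/
theorem pellQ'_le_pellQ (n : ℕ) : pellQ' n ≤ pellQ n := by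
  induction n with
  | zero => simp
  | succ n ih => rw [pellQ_succ, pellQ'_succ]; omega

/-- **Growth**: `2^n ≤ q_n`. [folklore] -/
theorem two_pow_le_pellQ (n : ℕ) : 2 ^ n ≤ pellQ n := by
  induction n with
  | zero => simp
  | succ n ih => rw [pellQ_succ, pow_succ]; omega

/-- `0 < q_n`. [folklore] -/
theorem pellQ_pos (n : ℕ) : 0 < pellQ n := lt_of_lt_of_le (Nat.two_pow_pos n) (two_pow_le_pellQ n)

/-- `q_n ≤ 3^n`. [folklore] -/
theorem pellQ_le_three_pow (n : ℕ) : pellQ n ≤ 3 ^ n := by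
  induction n with
  | zero => simp
  | succ n ih =>
    rw [pellQ_succ, pow_succ]
    have := pellQ'_le_pellQ n
    omega

/-- `q_n ≤ p_n ≤ 2 q_n`. [folklore] -/
theorem pellP_le (n : ℕ) : pellP n ≤ 2 * pellQ n := by
  unfold pellP; have := pellQ'_le_pellQ n; omega

/-- `q_n ≤ p_n`. [folklore] -/
theorem pellQ_le_pellP (n : ℕ) : pellQ n ≤ pellP n := Nat.le_add_right _ _

/-- **Pell's equation**: `p_n² − 2 q_n² = (−1)^{n+1}`. [folklore] -/
theorem pellP_sq_sub (n : ℕ) : (pellP n : ℤ) ^ 2 - 2 * (pellQ n : ℤ) ^ 2 = (-1) ^ (n + 1) := by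
  induction n with
  | zero => simp [pellP]
  | succ n ih =>
    have e1 : (pellP (n + 1) : ℤ) = 3 * pellQ n + pellQ' n := by
      simp only [pellP, pellQ_succ, pellQ'_succ]; push_cast; ring
    have e2 : (pellQ (n + 1) : ℤ) = 2 * pellQ n + pellQ' n := by
      simp only [pellQ_succ]; push_cast; ring
    have e0 : (pellP n : ℤ) = pellQ n + pellQ' n := by simp only [pellP]; push_cast; ring
    rw [e0] at ih
    rw [e1, e2, pow_succ (-1 : ℤ) (n + 1)]
    linear_combination (-1 : ℤ) * ih

/-- **The convergents approximate `√2`**: `|p_n − √2 q_n| · q_n < 1`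
(`|p − √2 q| (p + √2 q) = |p² − 2q²| = 1` and `q < p + √2 q`). [folklore] -/
theorem abs_pellP_sub_lt (n : ℕ) :
    |(pellP n : ℝ) - Real.sqrt 2 * pellQ n| * pellQ n < 1 := by
  have hq : (0 : ℝ) < pellQ n := by exact_mod_cast pellQ_pos n
  have hp : (pellQ n : ℝ) ≤ pellP n := by exact_mod_cast pellQ_le_pellP n
  have hs : Real.sqrt 2 ^ 2 = 2 := Real.sq_sqrt (by norm_num)
  have hs0 : 0 ≤ Real.sqrt 2 := Real.sqrt_nonneg 2
  have hcass : ((pellP n : ℝ) ^ 2 - 2 * (pellQ n : ℝ) ^ 2) = (-1) ^ (n + 1) := by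
    exact_mod_cast pellP_sq_sub n
  have habs : |(pellP n : ℝ) ^ 2 - 2 * (pellQ n : ℝ) ^ 2| = 1 := by
    rw [hcass, abs_pow, abs_neg, abs_one, one_pow]
  have hfac : (pellP n : ℝ) ^ 2 - 2 * (pellQ n : ℝ) ^ 2 =
      ((pellP n : ℝ) - Real.sqrt 2 * pellQ n) * ((pellP n : ℝ) + Real.sqrt 2 * pellQ n) := by
    have : ((pellP n : ℝ) - Real.sqrt 2 * pellQ n) * ((pellP n : ℝ) + Real.sqrt 2 * pellQ n) =
        (pellP n : ℝ) ^ 2 - Real.sqrt 2 ^ 2 * (pellQ n : ℝ) ^ 2 := by ring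
    rw [this, hs]
  have hpos : 0 < (pellP n : ℝ) + Real.sqrt 2 * pellQ n := by positivity
  have key : |(pellP n : ℝ) - Real.sqrt 2 * pellQ n| * ((pellP n : ℝ) + Real.sqrt 2 * pellQ n) = 1 := by
    rw [← abs_of_pos hpos, ← abs_mul, ← hfac, habs]
  have hne : |(pellP n : ℝ) - Real.sqrt 2 * pellQ n| ≠ 0 := fun h => by
    rw [h, zero_mul] at key; exact zero_ne_one key
  have habspos : 0 < |(pellP n : ℝ) - Real.sqrt 2 * pellQ n| :=
    lt_of_le_of_ne (abs_nonneg _) (Ne.symm hne)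
  have hlt : (pellQ n : ℝ) < (pellP n : ℝ) + Real.sqrt 2 * pellQ n := by nlinarith
  calc |(pellP n : ℝ) - Real.sqrt 2 * pellQ n| * pellQ n
      < |(pellP n : ℝ) - Real.sqrt 2 * pellQ n| * ((pellP n : ℝ) + Real.sqrt 2 * pellQ n) :=
        mul_lt_mul_of_pos_left hlt habspos
    _ = 1 := key

/-! ### `√2` is badly approximable (from `SqrtTwoDyadicThresholds.lean`) -/

/-- **Lower bound for nonzero `2a + √2 b`**, in the form used below: for integers `(a, b) ≠ 0`
and any `T ≥ max(1, |b|)`, `1/(4T) ≤ |2a + √2 b|`. For `b ≠ 0` this is Liouville's inequality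
`1/(4|b|) ≤ |√2 b − (−2a)|` of the tree (`SqrtTwoDyadic.one_div_le_abs_sqrt_two_mul_sub`); for
`b = 0`, `|2a| ≥ 2`. [folklore] -/
theorem quarter_div_le_abs {a b : ℤ} (h : a ≠ 0 ∨ b ≠ 0) {T : ℝ} (hT1 : 1 ≤ T) (hb : |(b : ℝ)| ≤ T) :
    1 / (4 * T) ≤ |2 * (a : ℝ) + Real.sqrt 2 * b| := by
  have hT4 : 1 / (4 * T) ≤ 1 / 4 := by
    rw [div_le_div_iff₀ (by positivity) (by norm_num)]; linarith
  by_cases hb0 : b = 0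
  · subst hb0
    have ha : a ≠ 0 := by
      rcases h with ha | hb'
      · exact ha
      · exact absurd rfl hb'
    have ha1 : (1 : ℝ) ≤ |(a : ℝ)| := by
      rw [← Int.cast_abs]; exact_mod_cast Int.one_le_abs ha
    simp only [Int.cast_zero, mul_zero, add_zero, abs_mul, abs_two]
    linarith
  · have hL := SqrtTwoDyadic.one_div_le_abs_sqrt_two_mul_sub (-2 * a) b hb0
    have e : Real.sqrt 2 * (b : ℝ) - ((-2 * a : ℤ) : ℝ) = 2 * (a : ℝ) + Real.sqrt 2 * b := by
      push_cast; ring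
    rw [e] at hL
    have hbpos : 0 < |(b : ℝ)| := abs_pos.2 (Int.cast_ne_zero.2 hb0)
    calc 1 / (4 * T) ≤ 1 / (4 * |(b : ℝ)|) := div_le_div_of_nonneg_left (by norm_num) (by positivity) (by linarith)
      _ ≤ _ := hL

/-! ### Sign transfer from `2A + √2 B` to `2qA + pB` -/

/-- **Sign transfer, positive case**: if `|p − √2 q| |B| < q |2A + √2 B|` and `2A + √2 B > 0`
then the integer `2qA + pB` is positive (`2qA + pB = q(2A + √2B) + (p − √2 q)B`). [folklore] -/
theorem sign_transfer_pos {A B : ℤ} {p q : ℕ}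
    (hδ : |(p : ℝ) - Real.sqrt 2 * q| * |(B : ℝ)| < q * |2 * (A : ℝ) + Real.sqrt 2 * B|)
    (hu : 0 < 2 * (A : ℝ) + Real.sqrt 2 * B) : 0 < 2 * (q : ℤ) * A + p * B := by
  have key : (2 * (q : ℝ) * A + p * B : ℝ) =
      q * (2 * A + Real.sqrt 2 * B) + ((p : ℝ) - Real.sqrt 2 * q) * B := by ring
  have h1 : |((p : ℝ) - Real.sqrt 2 * q) * (B : ℝ)| < q * (2 * A + Real.sqrt 2 * B) := by
    rw [abs_mul]; rwa [abs_of_pos hu] at hδ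
  have h2 := neg_abs_le (((p : ℝ) - Real.sqrt 2 * q) * (B : ℝ))
  have : (0 : ℝ) < 2 * (q : ℝ) * A + p * B := by rw [key]; linarith
  exact_mod_cast this

/-- **Sign transfer, negative case.** [folklore] -/
theorem sign_transfer_neg {A B : ℤ} {p q : ℕ}
    (hδ : |(p : ℝ) - Real.sqrt 2 * q| * |(B : ℝ)| < q * |2 * (A : ℝ) + Real.sqrt 2 * B|)
    (hu : 2 * (A : ℝ) + Real.sqrt 2 * B < 0) : 2 * (q : ℤ) * A + p * B < 0 := by
  have key : (2 * (q : ℝ) * A + p * B : ℝ) =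
      q * (2 * A + Real.sqrt 2 * B) + ((p : ℝ) - Real.sqrt 2 * q) * B := by ring
  have h1 : |((p : ℝ) - Real.sqrt 2 * q) * (B : ℝ)| < q * -(2 * A + Real.sqrt 2 * B) := by
    rw [abs_mul]; rwa [abs_of_neg hu] at hδ
  have h2 := le_abs_self (((p : ℝ) - Real.sqrt 2 * q) * (B : ℝ))
  have : (2 * (q : ℝ) * A + p * B : ℝ) < 0 := by rw [key]; linarith
  exact_mod_cast this

/-! ### The postselected pair counts -/

variable {M : ℕ}

/-- **The event sign** of an outcome: `2·[out = post = 1] − [post = 1]`, i.e. `+1` if wires `0`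
and `1` both read `1`, `−1` if wire `1` reads `1` and wire `0` reads `0`, and `0` if the
postselection wire `1` reads `0` (also `0` on registers with fewer than two wires) — "`z`
beginning with `11`" on one side of the ledger, "`z` beginning with `10`" on the other.
[cite: Aaronson2005, Prop. 2 (proof: the sums S₁ and S₀)] -/
def evSign (z : QReg M) : ℤ :=
  if h : 1 < M then (if z ⟨1, h⟩ = true then (if z ⟨0, by omega⟩ = true then 1 else -1) else 0)
  else 0

/-- `|evSign z| ≤ 1`. [folklore] -/
theorem abs_evSign_le (z : QReg M) : |evSign z| ≤ 1 := by
  unfold evSign; split_ifs <;> simp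

/-- The indicator of the postselection event `[post = 1]`. [cite: Aaronson2005, Def. 1 (i)] -/
def postInd (z : QReg M) : ℤ :=
  if h : 1 < M then (if z ⟨1, h⟩ = true then 1 else 0) else 0

/-- `|postInd z| ≤ 1`. [folklore] -/
theorem abs_postInd_le (z : QReg M) : |postInd z| ≤ 1 := by
  unfold postInd; split_ifs <;> simp

/-- The event sign as `2·[out ∧ post] − [post]`, against a weight. [folklore] -/
theorem evSign_mul_eq (hM : 1 < M) (z : QReg M) (X : ℝ) :
    (evSign z : ℝ) * X =
      2 * (if z ⟨0, by omega⟩ = true ∧ z ⟨1, hM⟩ = true then X else 0) -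
        (if z ⟨1, hM⟩ = true then X else 0) := by
  unfold evSign
  rw [dif_pos hM]
  by_cases h1 : z ⟨1, hM⟩ = true
  · by_cases h0 : z ⟨0, by omega⟩ = true
    · rw [if_pos h1, if_pos h0, if_pos ⟨h0, h1⟩, if_pos h1]; push_cast; ring
    · rw [if_pos h1, if_neg h0, if_neg (fun h => h0 h.1), if_pos h1]; push_cast; ring
  · rw [if_neg h1, if_neg (fun h => h1 h.2), if_neg h1]; push_cast; ring

/-- The postselection indicator against a weight. [folklore] -/
theorem postInd_mul_eq (hM : 1 < M) (z : QReg M) (X : ℝ) :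
    (postInd z : ℝ) * X = (if z ⟨1, hM⟩ = true then X else 0) := by
  unfold postInd
  rw [dif_pos hM]
  by_cases h1 : z ⟨1, hM⟩ = true
  · rw [if_pos h1, if_pos h1]; push_cast; ring
  · rw [if_neg h1, if_neg h1]; push_cast; ring

/-- **The integer part `A = Σ_z evSign(z) · pairSumA(z)`** of the signed pair count
`2^h (S₁ − S₀)`. [cite: Aaronson2005, Prop. 2 (proof)] -/
def postA (gs : List (QGate cliffordT M)) (w : QReg M) : ℤ :=
  ∑ z : QReg M, evSign z * pairSumA gs w z

/-- **The `√2/2`-part `B = Σ_z evSign(z) · pairSumB(z)`** of `2^h (S₁ − S₀)`.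
[cite: Aaronson2005, Prop. 2 (proof)] -/
def postB (gs : List (QGate cliffordT M)) (w : QReg M) : ℤ :=
  ∑ z : QReg M, evSign z * pairSumB gs w z

/-- The integer part of `2^h Pr[post = 1]`. [cite: Aaronson2005, Def. 1 (i)] -/
def postQA (gs : List (QGate cliffordT M)) (w : QReg M) : ℤ :=
  ∑ z : QReg M, postInd z * pairSumA gs w z

/-- The `√2/2`-part of `2^h Pr[post = 1]`. [cite: Aaronson2005, Def. 1 (i)] -/
def postQB (gs : List (QGate cliffordT M)) (w : QReg M) : ℤ :=
  ∑ z : QReg M, postInd z * pairSumB gs w z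

/-- `Pr[post = 1]` after the `ζ`-semantics of `gs` on `|w⟩` (`2 ≤ M`). [cite: Aaronson2005, Def. 1 (i)] -/
def probPost (ζ : ℂ) (gs : List (QGate cliffordT M)) (w : QReg M) (hM : 1 < M) : ℝ :=
  ∑ z : QReg M, if z ⟨1, hM⟩ = true then ‖(prodZeta ζ gs *ᵥ basisState w) z‖ ^ 2 else 0

/-- `Pr[out = 1 ∧ post = 1]` after the `ζ`-semantics of `gs` on `|w⟩` (`2 ≤ M`).
[cite: Aaronson2005, Def. 1 (ii)] -/
def probJoint (ζ : ℂ) (gs : List (QGate cliffordT M)) (w : QReg M) (hM : 1 < M) : ℝ :=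
  ∑ z : QReg M, if z ⟨0, by omega⟩ = true ∧ z ⟨1, hM⟩ = true then
    ‖(prodZeta ζ gs *ᵥ basisState w) z‖ ^ 2 else 0

variable {ζ : ℂ}

/-- `0 ≤ Pr[post]`. [folklore] -/
theorem probPost_nonneg (gs : List (QGate cliffordT M)) (w : QReg M) (hM : 1 < M) :
    0 ≤ probPost ζ gs w hM :=
  Finset.sum_nonneg fun z _ => by split_ifs <;> positivity

/-- `0 ≤ Pr[out ∧ post]`. [folklore] -/
theorem probJoint_nonneg (gs : List (QGate cliffordT M)) (w : QReg M) (hM : 1 < M) :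
    0 ≤ probJoint ζ gs w hM :=
  Finset.sum_nonneg fun z _ => by split_ifs <;> positivity

/-- `Pr[out ∧ post] ≤ Pr[post]`. [folklore] -/
theorem probJoint_le_probPost (gs : List (QGate cliffordT M)) (w : QReg M) (hM : 1 < M) :
    probJoint ζ gs w hM ≤ probPost ζ gs w hM := by
  unfold probJoint probPost
  refine Finset.sum_le_sum fun z _ => ?_
  by_cases h1 : z ⟨1, hM⟩ = true
  · by_cases h0 : z ⟨0, by omega⟩ = true
    · simp [h0, h1]
    · rw [if_neg (fun h => h0 h.1), if_pos h1]
      positivity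
  · rw [if_neg (fun h => h1 h.2), if_neg h1]

/-! ### Bounds on the pair counts -/

/-- The number of pairs of choice strings: `4^μ`, written `2^μ · 2^μ`. [folklore] -/
theorem card_pairs (μ : ℕ) :
    (Finset.univ : Finset (Fin μ → Bool)).card = 2 ^ μ := by
  rw [Finset.card_univ, Fintype.card_fun, Fintype.card_bool, Fintype.card_fin]

/-- `|pairSumA| ≤ 4^μ` (a sum of `4^μ` terms `reA d ∈ {0, ±1}`). [folklore] -/
theorem abs_pairSumA_le (gs : List (QGate cliffordT M)) (w z : QReg M) :
    |pairSumA gs w z| ≤ 2 ^ gs.length * 2 ^ gs.length := by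
  unfold pairSumA
  refine (Finset.abs_sum_le_sum_abs _ _).trans ?_
  calc ∑ b : Fin gs.length → Bool, |∑ b' : Fin gs.length → Bool,
          (match pairDiff gs w z (List.ofFn b) (List.ofFn b') with | some d => reA d | none => 0)|
        ≤ ∑ _b : Fin gs.length → Bool, ∑ _b' : Fin gs.length → Bool, (1 : ℤ) :=
          Finset.sum_le_sum fun b _ => (Finset.abs_sum_le_sum_abs _ _).trans
            (Finset.sum_le_sum fun b' _ => by
              rcases pairDiff gs w z (List.ofFn b) (List.ofFn b') with _ | d
              · simp
              · rcases d with _ | _ | _ | _ | _ | _ | _ | _ | d <;> simp [reA])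
    _ = 2 ^ gs.length * 2 ^ gs.length := by simp

/-- `|pairSumB| ≤ 4^μ` (a sum of `4^μ` terms `reB d ∈ {0, ±1}`). [folklore] -/
theorem abs_pairSumB_le (gs : List (QGate cliffordT M)) (w z : QReg M) :
    |pairSumB gs w z| ≤ 2 ^ gs.length * 2 ^ gs.length := by
  unfold pairSumB
  refine (Finset.abs_sum_le_sum_abs _ _).trans ?_
  calc ∑ b : Fin gs.length → Bool, |∑ b' : Fin gs.length → Bool,
          (match pairDiff gs w z (List.ofFn b) (List.ofFn b') with | some d => reB d | none => 0)|
        ≤ ∑ _b : Fin gs.length → Bool, ∑ _b' : Fin gs.length → Bool, (1 : ℤ) :=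
          Finset.sum_le_sum fun b _ => (Finset.abs_sum_le_sum_abs _ _).trans
            (Finset.sum_le_sum fun b' _ => by
              rcases pairDiff gs w z (List.ofFn b) (List.ofFn b') with _ | d
              · simp
              · rcases d with _ | _ | _ | _ | _ | _ | _ | _ | d <;> simp [reB])
    _ = 2 ^ gs.length * 2 ^ gs.length := by simp

/-- **The size bound** `T = 2^M · 4^μ` for the signed sums over outcomes. [folklore] -/
def bnd (gs : List (QGate cliffordT M)) : ℤ := 2 ^ M * (2 ^ gs.length * 2 ^ gs.length)

/-- `1 ≤ T`. [folklore] -/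
theorem one_le_bnd (gs : List (QGate cliffordT M)) : 1 ≤ bnd gs := by
  unfold bnd
  have h1 : (1 : ℤ) ≤ 2 ^ M := one_le_pow₀ (by norm_num)
  have h2 : (1 : ℤ) ≤ 2 ^ gs.length := one_le_pow₀ (by norm_num)
  nlinarith

/-- The register has `2^M` basis labels. [folklore] -/
theorem card_QReg : Fintype.card (QReg M) = 2 ^ M := by simp [QReg]

/-- A signed sum over outcomes of pair counts with signs of modulus `≤ 1` is at most `T`.
[folklore] -/
theorem abs_sum_sign_mul_le (gs : List (QGate cliffordT M)) (s : QReg M → ℤ)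
    (hs : ∀ z, |s z| ≤ 1) (f : QReg M → ℤ) (hf : ∀ z, |f z| ≤ 2 ^ gs.length * 2 ^ gs.length) :
    |∑ z : QReg M, s z * f z| ≤ bnd gs := by
  refine (Finset.abs_sum_le_sum_abs _ _).trans ?_
  calc ∑ z : QReg M, |s z * f z| ≤ ∑ _z : QReg M, (2 : ℤ) ^ gs.length * 2 ^ gs.length :=
        Finset.sum_le_sum fun z _ => by
          rw [abs_mul]
          have h1 := hs z
          have h2 := hf z
          have h3 := abs_nonneg (f z)
          nlinarith
    _ = bnd gs := by simp [bnd]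

/-- `|postA| ≤ T`. [folklore] -/
theorem abs_postA_le (gs : List (QGate cliffordT M)) (w : QReg M) : |postA gs w| ≤ bnd gs :=
  abs_sum_sign_mul_le gs evSign abs_evSign_le _ (abs_pairSumA_le gs w)

/-- `|postB| ≤ T`. [folklore] -/
theorem abs_postB_le (gs : List (QGate cliffordT M)) (w : QReg M) : |postB gs w| ≤ bnd gs :=
  abs_sum_sign_mul_le gs evSign abs_evSign_le _ (abs_pairSumB_le gs w)

/-- `|postQA| ≤ T`. [folklore] -/
theorem abs_postQA_le (gs : List (QGate cliffordT M)) (w : QReg M) : |postQA gs w| ≤ bnd gs :=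
  abs_sum_sign_mul_le gs postInd abs_postInd_le _ (abs_pairSumA_le gs w)

/-- `|postQB| ≤ T`. [folklore] -/
theorem abs_postQB_le (gs : List (QGate cliffordT M)) (w : QReg M) : |postQB gs w| ≤ bnd gs :=
  abs_sum_sign_mul_le gs postInd abs_postInd_le _ (abs_pairSumB_le gs w)

/-! ### The signed pair sums are `2^h (2 Pr[out ∧ post] − Pr[post])` and `2^h Pr[post]` -/

/-- **`A + ε(√2/2) B = 2^h (2·Pr[out ∧ post] − Pr[post])`** for `ζ` as in
`two_pow_mul_normSq_amp` (`ε = 1`: the circuit; `ε = −1`: its Galois conjugate): the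
difference `S₁ − S₀` of the printed proof, scaled by `2^h`. [cite: Aaronson2005, Prop. 2 (proof: "which is greater … S₀ … or … S₁")] -/
theorem postA_add_postB_eq (hζ2 : ζ ^ 2 = Complex.I) (h8 : ζ ^ 8 = 1) (hstar : star ζ = ζ ^ 7)
    {ε : ℝ} (hre : ∀ d < 8, (ζ ^ d).re = reA d + ε * reB d * (Real.sqrt 2 / 2))
    (gs : List (QGate cliffordT M)) (hgs : ∀ g ∈ gs, g.IsOracleFree) (w : QReg M) (hM : 1 < M) :
    (postA gs w : ℝ) + ε * (Real.sqrt 2 / 2) * postB gs w =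
      (2 : ℝ) ^ hCount gs * (2 * probJoint ζ gs w hM - probPost ζ gs w hM) := by
  have key : ∀ z : QReg M, (evSign z : ℝ) * ((2 : ℝ) ^ hCount gs *
      ‖(prodZeta ζ gs *ᵥ basisState w) z‖ ^ 2) =
      evSign z * (pairSumA gs w z + ε * (Real.sqrt 2 / 2) * pairSumB gs w z) := fun z => by
    rw [two_pow_mul_normSq_amp hζ2 h8 hstar hre gs hgs w z]
  have hsum := Finset.sum_congr rfl fun z (_ : z ∈ Finset.univ) => key z
  have hL : ∑ z : QReg M, (evSign z : ℝ) * ((2 : ℝ) ^ hCount gs *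
      ‖(prodZeta ζ gs *ᵥ basisState w) z‖ ^ 2) =
      (2 : ℝ) ^ hCount gs * (2 * probJoint ζ gs w hM - probPost ζ gs w hM) := by
    rw [probJoint, probPost, Finset.mul_sum, mul_sub, Finset.mul_sum, Finset.mul_sum,
      ← Finset.sum_sub_distrib]
    refine Finset.sum_congr rfl fun z _ => ?_
    rw [evSign_mul_eq hM]
    split_ifs <;> ring
  have hR : ∑ z : QReg M, (evSign z : ℝ) * (pairSumA gs w z + ε * (Real.sqrt 2 / 2) * pairSumB gs w z) =
      (postA gs w : ℝ) + ε * (Real.sqrt 2 / 2) * postB gs w := by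
    simp only [postA, postB, Int.cast_sum, Int.cast_mul, Finset.mul_sum, ← Finset.sum_add_distrib]
    refine Finset.sum_congr rfl fun z _ => ?_
    ring
  rw [← hR, ← hsum, hL]

/-- **`A_Q + ε(√2/2) B_Q = 2^h Pr[post]`.** [cite: Aaronson2005, Def. 1 (i)] -/
theorem postQA_add_postQB_eq (hζ2 : ζ ^ 2 = Complex.I) (h8 : ζ ^ 8 = 1) (hstar : star ζ = ζ ^ 7)
    {ε : ℝ} (hre : ∀ d < 8, (ζ ^ d).re = reA d + ε * reB d * (Real.sqrt 2 / 2))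
    (gs : List (QGate cliffordT M)) (hgs : ∀ g ∈ gs, g.IsOracleFree) (w : QReg M) (hM : 1 < M) :
    (postQA gs w : ℝ) + ε * (Real.sqrt 2 / 2) * postQB gs w =
      (2 : ℝ) ^ hCount gs * probPost ζ gs w hM := by
  have key : ∀ z : QReg M, (postInd z : ℝ) * ((2 : ℝ) ^ hCount gs *
      ‖(prodZeta ζ gs *ᵥ basisState w) z‖ ^ 2) =
      postInd z * (pairSumA gs w z + ε * (Real.sqrt 2 / 2) * pairSumB gs w z) := fun z => by
    rw [two_pow_mul_normSq_amp hζ2 h8 hstar hre gs hgs w z]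
  have hsum := Finset.sum_congr rfl fun z (_ : z ∈ Finset.univ) => key z
  have hL : ∑ z : QReg M, (postInd z : ℝ) * ((2 : ℝ) ^ hCount gs *
      ‖(prodZeta ζ gs *ᵥ basisState w) z‖ ^ 2) = (2 : ℝ) ^ hCount gs * probPost ζ gs w hM := by
    rw [probPost, Finset.mul_sum]
    refine Finset.sum_congr rfl fun z _ => ?_
    rw [postInd_mul_eq hM]
    split_ifs <;> ring
  have hR : ∑ z : QReg M, (postInd z : ℝ) * (pairSumA gs w z + ε * (Real.sqrt 2 / 2) * pairSumB gs w z) =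
      (postQA gs w : ℝ) + ε * (Real.sqrt 2 / 2) * postQB gs w := by
    simp only [postQA, postQB, Int.cast_sum, Int.cast_mul, Finset.mul_sum, ← Finset.sum_add_distrib]
    refine Finset.sum_congr rfl fun z _ => ?_
    ring
  rw [← hR, ← hsum, hL]

/-! ### The sign theorem -/

/-- **The digit count**: with `n ≥ M + 2μ + 2` Pell steps, `q_n ≥ 4T`. [folklore] -/
theorem four_mul_bnd_le_pellQ (gs : List (QGate cliffordT M)) {n : ℕ} (hn : M + 2 * gs.length + 2 ≤ n) :
    4 * bnd gs ≤ (pellQ n : ℤ) := by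
  have h1 : (2 : ℤ) ^ n ≤ (pellQ n : ℤ) := by exact_mod_cast two_pow_le_pellQ n
  have h2 : (2 : ℤ) ^ (M + 2 * gs.length + 2) ≤ 2 ^ n := pow_le_pow_right₀ (by norm_num) hn
  have h3 : (2 : ℤ) ^ (M + 2 * gs.length + 2) = 4 * bnd gs := by
    unfold bnd; ring
  linarith

/-- The common core of the two sign cases: the hypothesis of sign transfer,
`|p_n − √2 q_n| · |B| < q_n · |2A + √2 B|`, from `Pr[post] > 0`, the gap
`|2 Pr[out ∧ post] − Pr[post]| ≥ Pr[post]/3` and `n ≥ M + 2μ + 2`. [cite: Aaronson2005, Prop. 2 (proof); Kuperberg2015, §2.4] -/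
theorem transfer_hyp (gs : List (QGate cliffordT M)) (hgs : ∀ g ∈ gs, g.IsOracleFree) (w : QReg M)
    (hM : 1 < M) {n : ℕ} (hn : M + 2 * gs.length + 2 ≤ n)
    (hpost : 0 < probPost omega gs w hM)
    (hgap : probPost omega gs w hM ≤ 3 * |2 * probJoint omega gs w hM - probPost omega gs w hM|) :
    |(pellP n : ℝ) - Real.sqrt 2 * pellQ n| * |(postB gs w : ℝ)| <
      pellQ n * |2 * (postA gs w : ℝ) + Real.sqrt 2 * postB gs w| := by
  -- the two identities for `ζ = ω`
  have hre : ∀ d < 8, (omega ^ d).re = reA d + 1 * reB d * (Real.sqrt 2 / 2) := fun d hd => by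
    rw [omega_pow_re d hd]; ring
  have hAB := postA_add_postB_eq omega_pow_two omega_pow_eight star_omega hre gs hgs w hM
  have hQ := postQA_add_postQB_eq omega_pow_two omega_pow_eight star_omega hre gs hgs w hM
  set h := hCount gs with hh
  set Q := probPost omega gs w hM with hQdef
  set J := probJoint omega gs w hM with hJdef
  set T : ℝ := (bnd gs : ℝ) with hT
  have hT1 : (1 : ℝ) ≤ T := by rw [hT]; exact_mod_cast one_le_bnd gs
  have hpow : (0 : ℝ) < (2 : ℝ) ^ h := by positivity
  -- bounds
  have bB : |(postB gs w : ℝ)| ≤ T := by rw [hT, ← Int.cast_abs]; exact_mod_cast abs_postB_le gs w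
  have bQB : |(postQB gs w : ℝ)| ≤ T := by rw [hT, ← Int.cast_abs]; exact_mod_cast abs_postQB_le gs w
  -- (QA, QB) ≠ 0
  have hne : postQA gs w ≠ 0 ∨ postQB gs w ≠ 0 := by
    by_contra hcon
    have h1 : postQA gs w = 0 := by by_contra h'; exact hcon (Or.inl h')
    have h2 : postQB gs w = 0 := by by_contra h'; exact hcon (Or.inr h')
    rw [h1, h2] at hQ
    simp only [Int.cast_zero, mul_zero, add_zero] at hQ
    have : (2 : ℝ) ^ h * Q = 0 := hQ.symm
    rcases mul_eq_zero.1 this with h0 | h0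
    · exact absurd h0 (ne_of_gt hpow)
    · exact absurd h0 (ne_of_gt hpost)
  -- Liouville: 2·2^h Q = |2 QA + √2 QB| ≥ 1/(4T)
  have hQ2 : 2 * (postQA gs w : ℝ) + Real.sqrt 2 * postQB gs w = 2 * ((2 : ℝ) ^ h * Q) := by
    rw [← hQ]; ring
  have hQlow : 1 / (4 * T) ≤ 2 * ((2 : ℝ) ^ h * Q) := by
    have hposQ : 0 < 2 * ((2 : ℝ) ^ h * Q) := by positivity
    have hL := quarter_div_le_abs hne hT1 bQB
    rwa [hQ2, abs_of_pos hposQ] at hL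
  -- |u| ≥ 2·2^h Q / 3 ≥ 1/(12T)
  have hu : 2 * (postA gs w : ℝ) + Real.sqrt 2 * postB gs w = 2 * ((2 : ℝ) ^ h * (2 * J - Q)) := by
    rw [← hAB]; ring
  have hulow : 1 / (12 * T) ≤ |2 * (postA gs w : ℝ) + Real.sqrt 2 * postB gs w| := by
    rw [hu, abs_mul, abs_two, abs_mul, abs_of_pos hpow]
    have h3 : (2 : ℝ) ^ h * Q ≤ 3 * ((2 : ℝ) ^ h * |2 * J - Q|) := by nlinarith
    calc 1 / (12 * T) = (1 / (4 * T)) / 3 := by field_simp; ring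
      _ ≤ (2 * ((2 : ℝ) ^ h * Q)) / 3 := by gcongr
      _ ≤ 2 * ((2 : ℝ) ^ h * |2 * J - Q|) := by linarith
  -- Pell
  have hq4 : 4 * T ≤ (pellQ n : ℝ) := by rw [hT]; exact_mod_cast four_mul_bnd_le_pellQ gs hn
  have hqpos : (0 : ℝ) < pellQ n := by exact_mod_cast pellQ_pos n
  have hpell := abs_pellP_sub_lt n
  -- assemble: LHS < T / q < q / (12 T) ≤ RHS
  have hδ : |(pellP n : ℝ) - Real.sqrt 2 * pellQ n| < 1 / pellQ n := by
    rw [lt_div_iff₀ hqpos]; exact hpell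
  have hTpos : (0 : ℝ) < T := by linarith
  calc |(pellP n : ℝ) - Real.sqrt 2 * pellQ n| * |(postB gs w : ℝ)|
      ≤ |(pellP n : ℝ) - Real.sqrt 2 * pellQ n| * T := mul_le_mul_of_nonneg_left bB (abs_nonneg _)
    _ ≤ (1 / pellQ n) * T := mul_le_mul_of_nonneg_right hδ.le hTpos.le
    _ < pellQ n * (1 / (12 * T)) := by
        -- T/q < q/(12T) ⟸ 12T² < q², from q ≥ 4T
        rw [div_mul_eq_mul_div, one_mul, mul_one_div, div_lt_div_iff₀ hqpos (by positivity)]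
        nlinarith
    _ ≤ pellQ n * |2 * (postA gs w : ℝ) + Real.sqrt 2 * postB gs w| :=
        mul_le_mul_of_nonneg_left hulow hqpos.le

/-- **Sign theorem, accepting case.** If `Pr[post] > 0` and `Pr[out ∧ post] ≥ (2/3) Pr[post]`
then the Pell-weighted count `2 q_n A + p_n B` is positive (`n ≥ M + 2μ + 2`).
[cite: Aaronson2005, Prop. 2 (proof) with Def. 1 (ii)] -/
theorem weight_pos (gs : List (QGate cliffordT M)) (hgs : ∀ g ∈ gs, g.IsOracleFree) (w : QReg M)
    (hM : 1 < M) {n : ℕ} (hn : M + 2 * gs.length + 2 ≤ n)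
    (hpost : 0 < probPost omega gs w hM)
    (hyes : 2 * probPost omega gs w hM ≤ 3 * probJoint omega gs w hM) :
    0 < 2 * (pellQ n : ℤ) * postA gs w + pellP n * postB gs w := by
  have hre : ∀ d < 8, (omega ^ d).re = reA d + 1 * reB d * (Real.sqrt 2 / 2) := fun d hd => by
    rw [omega_pow_re d hd]; ring
  have hAB := postA_add_postB_eq omega_pow_two omega_pow_eight star_omega hre gs hgs w hM
  have hpow : (0 : ℝ) < (2 : ℝ) ^ hCount gs := by positivity
  have hgap' : 0 < 2 * probJoint omega gs w hM - probPost omega gs w hM := by linarith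
  have hgap : probPost omega gs w hM ≤ 3 * |2 * probJoint omega gs w hM - probPost omega gs w hM| := by
    rw [abs_of_pos hgap']; linarith
  have hu : 0 < 2 * (postA gs w : ℝ) + Real.sqrt 2 * postB gs w := by
    have : 2 * (postA gs w : ℝ) + Real.sqrt 2 * postB gs w =
        2 * ((2 : ℝ) ^ hCount gs * (2 * probJoint omega gs w hM - probPost omega gs w hM)) := by
      rw [← hAB]; ring
    rw [this]; positivity
  exact sign_transfer_pos (transfer_hyp gs hgs w hM hn hpost hgap) hu

/-- **Sign theorem, rejecting case.** If `Pr[post] > 0` and `Pr[out ∧ post] ≤ (1/3) Pr[post]`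
then `2 q_n A + p_n B < 0` (`n ≥ M + 2μ + 2`). [cite: Aaronson2005, Prop. 2 (proof) with Def. 1 (iii)] -/
theorem weight_neg (gs : List (QGate cliffordT M)) (hgs : ∀ g ∈ gs, g.IsOracleFree) (w : QReg M)
    (hM : 1 < M) {n : ℕ} (hn : M + 2 * gs.length + 2 ≤ n)
    (hpost : 0 < probPost omega gs w hM)
    (hno : 3 * probJoint omega gs w hM ≤ probPost omega gs w hM) :
    2 * (pellQ n : ℤ) * postA gs w + pellP n * postB gs w < 0 := by
  have hre : ∀ d < 8, (omega ^ d).re = reA d + 1 * reB d * (Real.sqrt 2 / 2) := fun d hd => by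
    rw [omega_pow_re d hd]; ring
  have hAB := postA_add_postB_eq omega_pow_two omega_pow_eight star_omega hre gs hgs w hM
  have hpow : (0 : ℝ) < (2 : ℝ) ^ hCount gs := by positivity
  have hgap' : 2 * probJoint omega gs w hM - probPost omega gs w hM < 0 := by linarith
  have hgap : probPost omega gs w hM ≤ 3 * |2 * probJoint omega gs w hM - probPost omega gs w hM| := by
    rw [abs_of_neg hgap']; linarith
  have hu : 2 * (postA gs w : ℝ) + Real.sqrt 2 * postB gs w < 0 := by
    have : 2 * (postA gs w : ℝ) + Real.sqrt 2 * postB gs w =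
        2 * ((2 : ℝ) ^ hCount gs * (2 * probJoint omega gs w hM - probPost omega gs w hM)) := by
      rw [← hAB]; ring
    rw [this]
    have : (2 : ℝ) ^ hCount gs * (2 * probJoint omega gs w hM - probPost omega gs w hM) < 0 :=
      mul_neg_of_pos_of_neg hpow hgap'
    linarith
  exact sign_transfer_neg (transfer_hyp gs hgs w hM hn hpost hgap) hu

/-! ### Bridges to the family-level probabilities -/

/-- For an oracle-free family, `Pr[post = 1]` on `x` is `probPost ω` of the gate list of the
`|x|`-th circuit on the padded input (register with at least two wires). [cite: Aaronson2005, Def. 1 (i)] -/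
theorem postselectProbOn_eq_probPost {F : QCircuitFamily cliffordT} (hF : F.IsOracleFree)
    (x : List Bool) (hM : 1 < x.length + F.ancillas x.length) :
    F.postselectProbOn 0 x =
      probPost omega (F.circ x.length).gates (padInput x.get (F.ancillas x.length)) hM := by
  classical
  unfold QCircuitFamily.postselectProbOn QCircuit.postselectProb QCircuit.probEvent probPost
    QCircuit.runOn
  rw [← prodZeta_omega 0 (hF x.length), Finset.sum_filter]
  refine Finset.sum_congr rfl fun z _ => ?_
  have : z ∈ QCircuit.postselectEvent (x.length + F.ancillas x.length) ↔ z ⟨1, hM⟩ = true := by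
    simp only [QCircuit.postselectEvent, Set.mem_setOf_eq]
    exact ⟨fun ⟨_, h⟩ => h, fun h => ⟨hM, h⟩⟩
  simp only [this]

/-- For an oracle-free family, `Pr[out = 1 ∧ post = 1]` on `x` is `probJoint ω`.
[cite: Aaronson2005, Def. 1 (ii)] -/
theorem jointAcceptProbOn_eq_probJoint {F : QCircuitFamily cliffordT} (hF : F.IsOracleFree)
    (x : List Bool) (hM : 1 < x.length + F.ancillas x.length) :
    F.jointAcceptProbOn 0 x =
      probJoint omega (F.circ x.length).gates (padInput x.get (F.ancillas x.length)) hM := by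
  classical
  unfold QCircuitFamily.jointAcceptProbOn QCircuit.jointAcceptProb QCircuit.probEvent probJoint
    QCircuit.runOn
  rw [← prodZeta_omega 0 (hF x.length), Finset.sum_filter]
  refine Finset.sum_congr rfl fun z _ => ?_
  have : z ∈ QCircuit.jointAcceptEvent (x.length + F.ancillas x.length) ↔
      z ⟨0, by omega⟩ = true ∧ z ⟨1, hM⟩ = true := by
    simp only [QCircuit.jointAcceptEvent, Set.mem_setOf_eq]
    exact ⟨fun ⟨_, h0, h1⟩ => ⟨h0, h1⟩, fun ⟨h0, h1⟩ => ⟨hM, h0, h1⟩⟩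
  simp only [this]

/-- A positive postselection probability forces at least two wires (otherwise the
postselection event is empty). [cite: Aaronson2005, Def. 1 (i)] -/
theorem one_lt_of_postselectProbOn_pos {G : QGateSet} {F : QCircuitFamily G} {A : Language Bool}
    (x : List Bool) (h : 0 < F.postselectProbOn A x) : 1 < x.length + F.ancillas x.length := by
  classical
  by_contra hM
  unfold QCircuitFamily.postselectProbOn QCircuit.postselectProb QCircuit.probEvent at h
  rw [Finset.sum_eq_zero] at h
  · exact lt_irrefl _ h
  · intro z hz
    simp only [Finset.mem_filter, QCircuit.postselectEvent, Set.mem_setOf_eq] at hz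
    obtain ⟨-, hM', -⟩ := hz
    exact absurd hM' hM

end PostADH

end Literature.Computability.QuantumComplexity
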